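import Mathlib
import HarnessLib
import Summits.KontsevichZagierPeriods.KontsevichZagierPeriods.Theses.LinRedNormalForm
import Summits.KontsevichZagierPeriods.KontsevichZagierPeriods.Theorems.LinRedNormalFormDihedralNormalFormStubSimplexProductSplitAux1

/-!
# `DihedralNormalForm`, line `torus-descent-sum-shadow`, stub `stub_simplexProductSplit` (v6)

The stub `stub_simplexProductSplit` of the crux `DihedralNormalForm` (stmt-KontsevichZagierPeriods-3912,
route `LinRedNormalForm`, skeleton v6): **simplicial PRODUCT monomials are an exit**.  A convergent
simplicial Laurent monomial `[Δ_k, q·∏ tᵢ^{βᵢ}(1-tᵢ)^{γᵢ}∏_{i<j}(tᵢ-tⱼ)^{αᵢⱼ}]` on the open ordered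
simplex `Δ_k = {1 > t₀ > ⋯ > t_{k-1} > 0}` whose forms do not cross the seam `p` (`0 < p < k`;
`γⱼ = 0` for the small variables `j ≥ p`, `αᵢⱼ = 0` for `i + 1 < p ≤ j`: the small variables meet
the large ones only through the pivot `t_{p-1}`) is congruent modulo `KZ.relations` to
`KZ.of s₁ * KZ.of s₂ = KZ.of (s₁.prod s₂)` (`KZ.of_mul_of`) for two convergent simplicial Laurent
monomial representations `s₁`, `s₂` of dimensions `p` and `k - p`.  Writing `k = (p'+1) + t` and
`λ = t_{p'}` for the pivot:

* the dilation chart `u = t_{≥ p}/λ` read backwards, `C : (x ; u) ↦ (x ; λ·u)`, is a monomial chart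
  with Jacobian `λ^t` mapping `Δ_{p'+1} × Δ_t` bijectively onto `Δ_k`, so ONE rule-2 move
  (Kontsevich–Zagier's change of variables, `SimplexProductSplit.chart_transport`, Aux 1) relates
  `s` to any representation of `(F ∘ C) · λ^t` on the product domain and transports absolute
  convergence;
* **factorisation** (`smono_glue`): `(F ∘ C)(x ; u) · λ^t = F₁(x) · F₂(u)` with `F₁` the large-block
  monomial whose pivot exponent is shifted by
  `N = t + Σ_{j ≥ p} βⱼ + Σ_{j ≥ p} α_{p',j} + Σ_{p ≤ i < j} αᵢⱼ` and `F₂` the small-block monomial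
  whose letters `1 - u_m` carry the exponents `α_{p',·}` of the pivot row (`prod_beta_glue`,
  `prod_gamma_glue`, `prod_alpha_glue`, `prod_alpha_small`, `prod_bL`);
* both factors vanish nowhere and simplices have positive measure, so they converge absolutely by
  Tonelli read backwards (`integrableOn_factors`, Aux 1); this defines `s₁`, `s₂`
  (`exists_smonoRep`), and `(s₁.prod s₂).integrand = F₁ ⊗ F₂` (`KZ.IntegralRep.prod_integrand_eq`);
* `q = 0`: `s` and the product of two zero representations are relations outright.

References: M. Kontsevich, D. Zagier, *Periods* (2001), §1.2 rule (2), §4.1 (Fubini); F. Brown,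
*Multiple zeta values and periods of moduli spaces* `𝔐_{0,n}`, Ann. Sci. ÉNS 42 (2009), §2.2
(simplicial versus cubical coordinates `xᵢ = tᵢ/tᵢ₋₁`), §7 (product maps).
-/

noncomputable section

open MeasureTheory Set

namespace Summit.KontsevichZagierPeriods.DihedralNormalForm.TorusDescent

open Literature.NumberTheory.Transcendental

namespace SimplexProductSplit

/-! ## Factorisation of the integrand along the chart -/

section Factorisation

variable {p t : ℕ} (β γ : Fin (p + 1 + t) → ℤ) (α : Fin (p + 1 + t) → Fin (p + 1 + t) → ℤ)
  {x : Fin (p + 1) → ℝ} {u : Fin t → ℝ} {w : Fin (p + 1 + t) → ℝ}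

/-- The cross block of the braid product: below the pivot row the exponents vanish (seam
hypothesis), and the pivot row reads `(λ - λ u_m)^{α} = (λ (1 - u_m))^{α}`. -/
theorem prod_cross_glue
    (hα : ∀ i j : Fin (p + 1 + t), (i : ℕ) + 1 < p + 1 → p + 1 ≤ (j : ℕ) → α i j = 0) :
    ∏ a : Fin (p + 1), ∏ m : Fin t,
        (x a - x (Fin.last p) * u m) ^ α (Fin.castAdd t a) (Fin.natAdd (p + 1) m) =
      ∏ m, (x (Fin.last p) * (1 - u m)) ^ α (Fin.castAdd t (Fin.last p)) (Fin.natAdd (p + 1) m) := by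
  rw [Fin.prod_univ_castSucc]
  have h1 : ∏ a : Fin p, ∏ m : Fin t, (x (Fin.castSucc a) - x (Fin.last p) * u m) ^
      α (Fin.castAdd t (Fin.castSucc a)) (Fin.natAdd (p + 1) m) = 1 := by
    refine Finset.prod_eq_one fun a _ => Finset.prod_eq_one fun m _ => ?_
    rw [hα _ _ (by simp) (by simp), zpow_zero]
  rw [h1, one_mul]
  refine Finset.prod_congr rfl fun m _ => ?_
  rw [mul_one_sub]

/-- Collecting the pivot powers of the small braid block. -/
theorem prod_alpha_small (hl : x (Fin.last p) ≠ 0) :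
    ∏ m, ∏ m', (if m < m' then (x (Fin.last p) * (u m - u m')) ^
        α (Fin.natAdd (p + 1) m) (Fin.natAdd (p + 1) m') else (1:ℝ)) =
      x (Fin.last p) ^ (∑ m : Fin t, ∑ m' : Fin t,
          if m < m' then α (Fin.natAdd (p + 1) m) (Fin.natAdd (p + 1) m') else 0) *
        ∏ m, ∏ m', if m < m' then (u m - u m') ^ α (Fin.natAdd (p + 1) m) (Fin.natAdd (p + 1) m')
          else 1 := by
  rw [← prod_zpow_eq_zpow_sum _ _ hl, ← Finset.prod_mul_distrib]
  refine Finset.prod_congr rfl fun m _ => ?_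
  rw [← prod_zpow_eq_zpow_sum _ _ hl, ← Finset.prod_mul_distrib]
  refine Finset.prod_congr rfl fun m' _ => ?_
  split_ifs
  · exact mul_zpow _ _ _
  · rw [zpow_zero, one_mul]

/-- The `β`-product of the large block with the pivot exponent shifted by `N`. -/
theorem prod_bL (N : ℤ) (hx : ∀ a, x a ≠ 0) :
    ∏ a, x a ^ (β (Fin.castAdd t a) + if a = Fin.last p then N else 0) =
      (∏ a, x a ^ β (Fin.castAdd t a)) * x (Fin.last p) ^ N := by
  simp only [zpow_add₀ (hx _), Finset.prod_mul_distrib]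
  congr 1
  rw [Finset.prod_congr rfl fun a (_ : a ∈ Finset.univ) =>
    (show x a ^ (if a = Fin.last p then N else 0) =
      if a = Fin.last p then x a ^ N else 1 by split_ifs <;> simp)]
  rw [Finset.prod_ite_eq']
  simp

variable (hw₁ : ∀ a, w (Fin.castAdd t a) = x a)

include hw₁ in
/-- The `γ`-product over the glued configuration `w = (x ; λ·u)`: the small variables carry no
letter `1 - tⱼ` (seam hypothesis). -/
theorem prod_gamma_glue (hγ : ∀ i : Fin (p + 1 + t), p + 1 ≤ (i : ℕ) → γ i = 0) :
    ∏ i, (1 - w i) ^ γ i = ∏ a, (1 - x a) ^ γ (Fin.castAdd t a) := by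
  rw [Fin.prod_univ_add]
  have h2 : ∏ m : Fin t, (1 - w (Fin.natAdd (p + 1) m)) ^ γ (Fin.natAdd (p + 1) m) = 1 :=
    Finset.prod_eq_one fun m _ => by rw [hγ _ (by simp), zpow_zero]
  rw [h2, mul_one]
  simp only [hw₁]

variable (hw₂ : ∀ m, w (Fin.natAdd (p + 1) m) = x (Fin.last p) * u m)

include hw₁ hw₂

/-- The `β`-product over the glued configuration `w = (x ; λ·u)`. -/
theorem prod_beta_glue :
    ∏ i, w i ^ β i = (∏ a, x a ^ β (Fin.castAdd t a)) *
      ((∏ m, x (Fin.last p) ^ β (Fin.natAdd (p + 1) m)) * ∏ m, u m ^ β (Fin.natAdd (p + 1) m)) := by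
  rw [Fin.prod_univ_add]
  simp only [hw₁, hw₂, mul_zpow, Finset.prod_mul_distrib]

/-- The braid product over the glued configuration `w = (x ; λ·u)`: large block, pivot row
(`prod_cross_glue`) and small block `(λ u_m - λ u_{m'})^{α} = (λ (u_m - u_{m'}))^{α}`. -/
theorem prod_alpha_glue
    (hα : ∀ i j : Fin (p + 1 + t), (i : ℕ) + 1 < p + 1 → p + 1 ≤ (j : ℕ) → α i j = 0) :
    ∏ i, ∏ j, (if i < j then (w i - w j) ^ α i j else 1) =
      (∏ a, ∏ b, if a < b then (x a - x b) ^ α (Fin.castAdd t a) (Fin.castAdd t b) else 1) *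
        ((∏ m, (x (Fin.last p) * (1 - u m)) ^ α (Fin.castAdd t (Fin.last p)) (Fin.natAdd (p + 1) m)) *
          ∏ m, ∏ m', if m < m' then (x (Fin.last p) * (u m - u m')) ^
            α (Fin.natAdd (p + 1) m) (Fin.natAdd (p + 1) m') else 1) := by
  rw [Fin.prod_univ_add, ← prod_cross_glue α hα, ← mul_assoc, ← Finset.prod_mul_distrib]
  congr 1
  · refine Finset.prod_congr rfl fun a _ => ?_
    rw [Fin.prod_univ_add]
    congr 1
    · refine Finset.prod_congr rfl fun b _ => ?_
      simp only [(Fin.strictMono_castAdd t).lt_iff_lt, hw₁]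
    · refine Finset.prod_congr rfl fun m _ => ?_
      rw [if_pos (castAdd_lt_natAdd a m), hw₁, hw₂]
  · refine Finset.prod_congr rfl fun m _ => ?_
    rw [Fin.prod_univ_add]
    have h1 : ∏ b : Fin (p + 1), (if Fin.natAdd (p + 1) m < Fin.castAdd t b then
        (w (Fin.natAdd (p + 1) m) - w (Fin.castAdd t b)) ^
          α (Fin.natAdd (p + 1) m) (Fin.castAdd t b) else (1:ℝ)) = 1 :=
      Finset.prod_eq_one fun b _ => if_neg (not_lt.mpr (castAdd_lt_natAdd b m).le)
    rw [h1, one_mul]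
    refine Finset.prod_congr rfl fun m' _ => ?_
    simp only [Fin.natAdd_lt_natAdd_iff, hw₂, mul_sub]

/-- **Factorisation of the integrand along the chart.**  For `w = (x ; λ·u)`, `λ = x_{p}` and
`N = t + Σ_{j ≥ p+1} βⱼ + Σ_{j ≥ p+1} α_{p,j} + Σ_{p+1 ≤ i < j} αᵢⱼ`:
`F₁(x) · F₂(u) = F(w) · λ^t`, where `F` is the monomial of `(q, β, γ, α)`, `F₁` the large-block
monomial with pivot exponent `β_p + N`, and `F₂` the small-block monomial (coefficient `1`, letters
`1 - u_m` with the exponents of the pivot row). -/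
theorem smono_glue (q : ℚ) (N : ℤ)
    (hN : N = (t : ℤ) + (∑ m : Fin t, β (Fin.natAdd (p + 1) m)) +
      (∑ m : Fin t, α (Fin.castAdd t (Fin.last p)) (Fin.natAdd (p + 1) m)) +
      ∑ m : Fin t, ∑ m' : Fin t,
        if m < m' then α (Fin.natAdd (p + 1) m) (Fin.natAdd (p + 1) m') else 0)
    (hγ : ∀ i : Fin (p + 1 + t), p + 1 ≤ (i : ℕ) → γ i = 0)
    (hα : ∀ i j : Fin (p + 1 + t), (i : ℕ) + 1 < p + 1 → p + 1 ≤ (j : ℕ) → α i j = 0)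
    (hx : ∀ a, x a ≠ 0) :
    (q : ℝ) * ((∏ a, x a ^ (β (Fin.castAdd t a) + if a = Fin.last p then N else 0)) *
        (∏ a, (1 - x a) ^ γ (Fin.castAdd t a)) *
        ∏ a, ∏ b, if a < b then (x a - x b) ^ α (Fin.castAdd t a) (Fin.castAdd t b) else 1) *
      (((1 : ℚ) : ℝ) * ((∏ m, u m ^ β (Fin.natAdd (p + 1) m)) *
        (∏ m, (1 - u m) ^ α (Fin.castAdd t (Fin.last p)) (Fin.natAdd (p + 1) m)) *
        ∏ m, ∏ m', if m < m' then (u m - u m') ^ α (Fin.natAdd (p + 1) m) (Fin.natAdd (p + 1) m')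
          else 1)) =
    (q : ℝ) * ((∏ i, w i ^ β i) * (∏ i, (1 - w i) ^ γ i) *
        ∏ i, ∏ j, if i < j then (w i - w j) ^ α i j else 1) * x (Fin.last p) ^ t := by
  have hl : x (Fin.last p) ≠ 0 := hx _
  rw [prod_beta_glue β hw₁ hw₂, prod_gamma_glue γ hw₁ hγ, prod_alpha_glue α hw₁ hw₂ hα,
    prod_alpha_small α hl, prod_bL β N hx]
  simp only [mul_zpow, Finset.prod_mul_distrib, prod_zpow_eq_zpow_sum _ _ hl]
  rw [show x (Fin.last p) ^ N = x (Fin.last p) ^ t *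
      x (Fin.last p) ^ (∑ m : Fin t, β (Fin.natAdd (p + 1) m)) *
      x (Fin.last p) ^ (∑ m : Fin t, α (Fin.castAdd t (Fin.last p)) (Fin.natAdd (p + 1) m)) *
      x (Fin.last p) ^ (∑ m : Fin t, ∑ m' : Fin t,
        if m < m' then α (Fin.natAdd (p + 1) m) (Fin.natAdd (p + 1) m') else 0) by
    rw [hN, zpow_add₀ hl, zpow_add₀ hl, zpow_add₀ hl, zpow_natCast]]
  push_cast
  ring

end Factorisation

end SimplexProductSplit

open SimplexProductSplit in
/-- **`stub_simplexProductSplit`** (v6).  A convergent simplicial Laurent monomial on `Δ_k` whose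
forms do not cross the seam `p` (`0 < p < k`; `γⱼ = 0` for the small variables `j ≥ p`, and
`αᵢⱼ = 0` whenever `i + 1 < p ≤ j`) is congruent modulo `KZ.relations` to the product
`KZ.of s₁ * KZ.of s₂` of two convergent simplicial Laurent monomial representations of dimensions
`p` and `k - p`: the dilation chart `u_m = t_{p-1+m}/t_{p-1}`, read backwards as the monomial chart
`(x ; u) ↦ (x ; t_{p-1}·u)` with Jacobian `t_{p-1}^{k-p}`, is ONE rule-2 move from the product
representation `s₁.prod s₂` on `Δ_p × Δ_{k-p}` onto `s` (`SimplexProductSplit.chart_transport`), the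
integrand factorises (`SimplexProductSplit.smono_glue`), the factors converge by Tonelli
(`SimplexProductSplit.integrableOn_factors`), and `KZ.of (s₁.prod s₂) = KZ.of s₁ * KZ.of s₂`
(`KZ.of_mul_of`); for `q = 0` everything in sight is a relation.
[cite: KontsevichZagier2001, §1.2 rule (2)] -/
theorem stub_simplexProductSplit : ∀ (k p : ℕ) (q : ℚ) (β γ : Fin k → ℤ) (α : Fin k → Fin k → ℤ) (s : Literature.NumberTheory.Transcendental.KZ.IntegralRep k), 0 < p → p < k → s.domain = {t : Fin k → ℝ | (∀ i, 0 < t i) ∧ (∀ i, t i < 1) ∧ StrictAnti t} → Set.EqOn s.integrand (fun t => (q : ℝ) * ((∏ i : Fin k, t i ^ β i) * (∏ i : Fin k, (1 - t i) ^ γ i) * ∏ i : Fin k, ∏ j : Fin k, if i < j then (t i - t j) ^ α i j else 1)) s.domain → (∀ i : Fin k, p ≤ (i : ℕ) → γ i = 0) → (∀ i j : Fin k, (i : ℕ) + 1 < p → p ≤ (j : ℕ) → α i j = 0) → ∃ (d₁ d₂ : ℕ) (s₁ : Literature.NumberTheory.Transcendental.KZ.IntegralRep d₁) (s₂ : Literature.NumberTheory.Transcendental.KZ.IntegralRep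 d₂), d₁ < k ∧ d₂ < k ∧ Literature.NumberTheory.Transcendental.KZ.of s₁ ∈ {z : Literature.NumberTheory.Transcendental.KZ.FormalRep | ∃ (q : ℚ) (β γ : Fin d₁ → ℤ) (α : Fin d₁ → Fin d₁ → ℤ) (s : Literature.NumberTheory.Transcendental.KZ.IntegralRep d₁), s.domain = {t : Fin d₁ → ℝ | (∀ i, 0 < t i) ∧ (∀ i, t i < 1) ∧ StrictAnti t} ∧ Set.EqOn s.integrand (fun t => (q : ℝ) * ((∏ i : Fin d₁, t i ^ β i) * (∏ i : Fin d₁, (1 - t i) ^ γ i) * ∏ i : Fin d₁, ∏ j : Fin d₁, if i < j then (t i - t j) ^ α i j else 1)) s.domain ∧ z = Literature.NumberTheory.Transcendental.KZ.of s} ∧ Literature.NumberTheory.Transcendental.KZ.of s₂ ∈ {z : Literature.NumberTheory.Transcendental.KZ.FormalRep | ∃ (q : ℚ) (β γ : Fin d₂ → ℤ) (α : Fin d₂ → Fin d₂ → ℤ) (s : Literature.NumberTheory.Transcendental.KZ.IntegralRep d₂), s.domain = {t : Fin d₂ → ℝ | (∀ i, 0 < t i) ∧ (∀ i, t i < 1)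 ∧ StrictAnti t} ∧ Set.EqOn s.integrand (fun t => (q : ℝ) * ((∏ i : Fin d₂, t i ^ β i) * (∏ i : Fin d₂, (1 - t i) ^ γ i) * ∏ i : Fin d₂, ∏ j : Fin d₂, if i < j then (t i - t j) ^ α i j else 1)) s.domain ∧ z = Literature.NumberTheory.Transcendental.KZ.of s} ∧ Literature.NumberTheory.Transcendental.KZ.of s - Literature.NumberTheory.Transcendental.KZ.of s₁ * Literature.NumberTheory.Transcendental.KZ.of s₂ ∈ Literature.NumberTheory.Transcendental.KZ.relations := by
  intro k p q β γ α s hp hpk hdom hint hγ hα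
  obtain ⟨p, rfl⟩ : ∃ p', p = p' + 1 := ⟨p - 1, by omega⟩
  obtain ⟨t, rfl⟩ : ∃ t, k = p + 1 + t := ⟨k - (p + 1), by omega⟩
  by_cases hq : q = 0
  · -- `q = 0`: everything in sight is a relation
    subst hq
    obtain ⟨s₁, hd₁, hi₁⟩ := KZ.exists_zeroRep (KZ.isSemialgebraic_openOrderedSimplex (p + 1))
    obtain ⟨s₂, hd₂, hi₂⟩ := KZ.exists_zeroRep (KZ.isSemialgebraic_openOrderedSimplex t)
    refine ⟨p + 1, t, s₁, s₂, by omega, by omega,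
      ⟨0, 0, 0, 0, s₁, hd₁, fun x _ => by simp [hi₁], rfl⟩,
      ⟨0, 0, 0, 0, s₂, hd₂, fun x _ => by simp [hi₂], rfl⟩, ?_⟩
    rw [KZ.of_mul_of]
    refine sub_mem (KZ.of_mem_relations_of_eqOn_zero s fun x hx => ?_)
      (KZ.of_mem_relations_of_eqOn_zero _ fun x _ => ?_)
    · rw [hint hx]
      simp
    · rw [KZ.IntegralRep.prod_integrand_eq, KZ.IntegralRep.prodFun_apply, hi₁]
      simp
  · -- the exponent shift, the three monomials
    obtain ⟨N, hN⟩ : ∃ N : ℤ, N = (t : ℤ) + (∑ m : Fin t, β (Fin.natAdd (p + 1) m)) +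
        (∑ m : Fin t, α (Fin.castAdd t (Fin.last p)) (Fin.natAdd (p + 1) m)) +
        ∑ m : Fin t, ∑ m' : Fin t,
          if m < m' then α (Fin.natAdd (p + 1) m) (Fin.natAdd (p + 1) m') else 0 := ⟨_, rfl⟩
    obtain ⟨F, hF⟩ : ∃ F : (Fin (p + 1 + t) → ℝ) → ℝ, F = fun w => (q : ℝ) *
        ((∏ i, w i ^ β i) * (∏ i, (1 - w i) ^ γ i) *
          ∏ i, ∏ j, if i < j then (w i - w j) ^ α i j else 1) := ⟨_, rfl⟩
    obtain ⟨F₁, hF₁⟩ : ∃ F₁ : (Fin (p + 1) → ℝ) → ℝ, F₁ = fun x => (q : ℝ) *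
        ((∏ a, x a ^ (β (Fin.castAdd t a) + if a = Fin.last p then N else 0)) *
          (∏ a, (1 - x a) ^ γ (Fin.castAdd t a)) *
          ∏ a, ∏ b, if a < b then (x a - x b) ^ α (Fin.castAdd t a) (Fin.castAdd t b) else 1) :=
      ⟨_, rfl⟩
    obtain ⟨F₂, hF₂⟩ : ∃ F₂ : (Fin t → ℝ) → ℝ, F₂ = fun u => ((1 : ℚ) : ℝ) *
        ((∏ m, u m ^ β (Fin.natAdd (p + 1) m)) *
          (∏ m, (1 - u m) ^ α (Fin.castAdd t (Fin.last p)) (Fin.natAdd (p + 1) m)) *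
          ∏ m, ∏ m', if m < m' then
            (u m - u m') ^ α (Fin.natAdd (p + 1) m) (Fin.natAdd (p + 1) m') else 1) := ⟨_, rfl⟩
    -- the chart `(x ; u) ↦ (x ; λ·u)` as a monomial chart
    obtain ⟨S, hS⟩ : ∃ S : Fin (p + 1 + t) → Finset (Fin (p + 1 + t)),
        ∀ i, S i = if (i : ℕ) ≤ p then {i} else {Fin.castAdd t (Fin.last p), i} :=
      ⟨_, fun _ => rfl⟩
    have hS₁ : ∀ a : Fin (p + 1), S (Fin.castAdd t a) = {Fin.castAdd t a} := fun a => by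
      rw [hS, if_pos]
      exact Nat.le_of_lt_succ a.2
    have hS₂ : ∀ m : Fin t,
        S (Fin.natAdd (p + 1) m) = {Fin.castAdd t (Fin.last p), Fin.natAdd (p + 1) m} := fun m => by
      rw [hS, if_neg]
      rw [Fin.val_natAdd]
      omega
    obtain ⟨C, hC⟩ : ∃ C : (Fin (p + 1 + t) → ℝ) → Fin (p + 1 + t) → ℝ,
        ∀ z i, C z i = ∏ j ∈ S i, z j := ⟨_, fun _ _ => rfl⟩
    have hC₁ : ∀ z a, C z (Fin.castAdd t a) = z (Fin.castAdd t a) := fun z a => by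
      rw [hC, prod_rows_castAdd hS₁]
    have hC₂ : ∀ z m, C z (Fin.natAdd (p + 1) m) =
        z (Fin.castAdd t (Fin.last p)) * z (Fin.natAdd (p + 1) m) := fun z m => by
      rw [hC, prod_rows_natAdd hS₂]
    -- ONE rule-2 move along the chart; the pulled-back integrand is `F₁ ⊗ F₂`
    obtain ⟨hex, hmove⟩ := chart_transport hS₁ hS₂ hC
      (fun z => F₁ (fun i => z (Fin.castAdd t i)) * F₂ (fun j => z (Fin.natAdd (p + 1) j))) F
      (fun z hz => by
        simp only [hF₁, hF₂, hF]
        exact smono_glue β γ α (hC₁ z) (hC₂ z) q N hN hγ hα fun a => (hz.1.1 a).ne')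
    have hint' : EqOn s.integrand F s.domain := by rw [hF]; exact hint
    obtain ⟨r, hrd, hri⟩ := hex s hdom hint'
    have hI := r.integrableOn
    rw [hrd, hri] at hI
    -- the factors converge (Tonelli) and define `s₁`, `s₂`
    obtain ⟨h₁, h₂⟩ := integrableOn_factors (f := F₁) (g := F₂)
      (KZ.measurableSet_openOrderedSimplex _) (KZ.measurableSet_openOrderedSimplex _)
      (volume_openOrderedSimplex_ne_zero _) (volume_openOrderedSimplex_ne_zero _)
      (fun x hx => by rw [hF₁]; exact smono_ne_zero hq _ _ _ hx)
      (fun y hy => by rw [hF₂]; exact smono_ne_zero one_ne_zero _ _ _ hy) hI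
    rw [hF₁] at h₁
    rw [hF₂] at h₂
    obtain ⟨s₁, hd₁, hi₁⟩ := exists_smonoRep (p + 1) q
      (fun a => β (Fin.castAdd t a) + if a = Fin.last p then N else 0)
      (fun a => γ (Fin.castAdd t a)) (fun a b => α (Fin.castAdd t a) (Fin.castAdd t b)) h₁
    obtain ⟨s₂, hd₂, hi₂⟩ := exists_smonoRep t 1 (fun m => β (Fin.natAdd (p + 1) m))
      (fun m => α (Fin.castAdd t (Fin.last p)) (Fin.natAdd (p + 1) m))
      (fun m m' => α (Fin.natAdd (p + 1) m) (Fin.natAdd (p + 1) m')) h₂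
    have hE := hmove (s₁.prod s₂) s
      (by
        ext z
        rw [KZ.IntegralRep.prod_domain, KZ.IntegralRep.mem_prodDomain, hd₁, hd₂]
        rfl)
      (fun z _ => by
        rw [KZ.IntegralRep.prod_integrand_eq, KZ.IntegralRep.prodFun_apply, hi₁, hi₂, hF₁, hF₂])
      hdom hint'
    refine ⟨p + 1, t, s₁, s₂, by omega, by omega,
      ⟨q, _, _, _, s₁, hd₁, fun x _ => by rw [hi₁], rfl⟩,
      ⟨1, _, _, _, s₂, hd₂, fun x _ => by rw [hi₂], rfl⟩, ?_⟩
    rw [KZ.of_mul_of]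
    exact hE.symm

end Summit.KontsevichZagierPeriods.DihedralNormalForm.TorusDescent

end
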